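import Literature.Geometry.Lorentzian.SoundNearKerrLeaf
import Summits.FinalStateConjecture.FinalStateConjecture.Theorems.SeamedChartsExhaust.Negative.ReversedFlatChart
import HarnessLib

/-!
# Stub `stub_minkowskiSoundLeaf` of crux `Capture` (stmt-FinalStateConjecture-10115):
# SOUND ANTI-VACUITY — Minkowski spacetime has exact sound `0`-hole leaves beyond every `J⁻(K)`

The crux `Capture` (routes `BartnikGapSettling` / `QuietWindowCapture`, summit
`FinalStateConjecture`) is being re-typed over the SOUND leaf predicate
`CauchyDevelopment.IsSoundNearKerrLeaf 𝒟 k ε N M a S` (`Literature/…/SoundNearKerrLeaf.lean`, second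
revision of the repaired predicate): the twenty-clause block of `IsNearKerrLeaf` verbatim, then
(S₁) thick honest discs `2 Mᵢ ≤ Rᵢ`, (S₂) `Cᵏ` certification of each hole chart on its whole
near-zone layer, (S₃) `Cᵏ` certification of the flat chart on its whole LAYER `L₀ = {−1 < t₀ < 1}`,
(S₄) pairwise disjointness of the flat-frame near-zone tubes, and (S₅) achronality of the flat
SHEET `Ψ₀ '' {t₀ = 0}`.  This file proves the registered sanity stub `stub_minkowskiSoundLeaf`
(verbatim signature), the sound analogue of `stub_minkowski{,Honest}Leaf` (sibling files, whose
private lemmas are reproduced here): the Minkowski development `Minkowski.vacuumCauchyDevelopment`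
of the trivial datum `(ℝ³, δ, 0)` has, for EVERY `k`, EVERY `ε : ℝ≥0∞` (even `ε = 0`) and every
compact `K ⊆ ℝ⁴`, a SOUND `0`-hole `(ε, k)`-near-Kerr leaf `S` disjoint from `J⁻(K)` — so the
re-typed crux hypothesis and its sound `N = 0` sector are inhabited (not vacuous).

Construction.  Write `τ(x) = x⁰ − √(1 + |x̲|²)` for the hyperboloidal time of the flat background
`hypBackground ⊤` and `e₀ = ∂ₜ`.  Bound the time coordinate on the compact `K` by `T ≥ 0`.  Flat
domain `U₀ = ⊤`, flat chart the time translation `Ψ₀ y = y + T e₀` (`τ(Ψ₀ y) = τ(y) + T`), layers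
`L₀ = {−1 < τ < 1}`, `W₀ = {0 < τ < 1}`, leaf = flat sheet
`S = Ψ₀ {τ = 0} = {τ = T} = {x⁰ = T + √(1 + |x̲|²)}`, no hole (all `Fin 0`-indexed data empty, all
`Fin 0`-clauses vacuous — in particular (S₁), (S₂), (S₄)).  The flat chart is smooth, an open
embedding of the (open) layer, charted into `J⁺({x⁰ = 0}) ⊇ {x⁰ ≥ 0}`, and its deviation from `η`
VANISHES IDENTICALLY on `U₀ = ⊤` (its differential is the identity and `η` is constant), so the
zero-extended deviation is the zero function and both the slab clause (14) and the LAYER clause (S₃)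
hold with `0 ≤ ε` (`supCkENorm_zero`); `Ψ₀ W₀ = {T < τ < T + 1} ⊆ I⁺(S)` by vertical timelike
segments; the BARRIER `exteriorOf W ∖ W ⊆ J⁻(S)` because `τ` is non-decreasing along the causal
relation of Minkowski space (`J⁺(p) = {‖q̲ − p̲‖ ≤ q⁰ − p⁰}`, `Minkowski.causalFuture_singleton`,
and `√(1 + s²)` is `1`-Lipschitz), so a point of `I⁻(W) ∖ W` has `τ ≤ T` and lies vertically below
`p + (T − τ p) e₀ ∈ S`.  Disjointness from `J⁻(K)`: on `J⁻(K)` the time coordinate is `≤ T`, on `S`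
it is `≥ T + 1`.  ACHRONALITY (S₅) of the sheet `S` (as in `Minkowski.isAchronal_stretchLeaf_one`,
the constant `T` cancelling): for `q, q' ∈ S`, `q' ∈ I⁺(q) ⊆ J⁺(q)` gives
`‖q̲' − q̲‖ ≤ q'⁰ − q⁰ = √(1 + |q̲'|²) − √(1 + |q̲|²) ≤ ||q̲'| − |q̲|| ≤ ‖q̲' − q̲‖`, so (strictness
off the diagonal) `q = q'`, contradicting chronology (`CauchyDevelopment.isChronological`).

No named facts are used and no definitions are introduced.  References: Hawking–Ellis 1973, §5.1
(Minkowski space; the spacelike hyperboloids); O'Neill 1983, Ch. 14, p. 402 (causality of `ℝ⁴₁`),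
p. 413 (achronal sets); Dafermos–Holzegel–Rodnianski–Taylor arXiv:2104.08222, §1 (leaf vocabulary).
-/

-- the doubled `FinalStateConjecture.FinalStateConjecture` path component trips dupNamespace
set_option linter.dupNamespace false

noncomputable section

namespace Summit.FinalStateConjecture.FinalStateConjecture.Theorems.BartnikGapSettling.Capture

open Set Filter Topology TopologicalSpace
open scoped Manifold ContDiff ENNReal
open Literature.Geometry.Lorentzian
-- `ReversedModel.*`: vertical timelike segments and `J⁻` of points in Minkowski spacetime
open Summit.FinalStateConjecture.FinalStateConjecture.Theorems.SeamedChartsExhaust.Negative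

/-! ### §1 Time translations and the hyperboloidal time `τ(x) = x⁰ − √(1 + |x̲|²)` -/

/-- The time coordinate of `x + s e₀` is `x⁰ + s`. [folklore] -/
private theorem time_add_smul (x : E4) (s : ℝ) : (x + s • E4.basisVector 0) 0 = x 0 + s := by
  simp

/-- The spatial part of `x + s e₀` is that of `x`. [folklore] -/
private theorem spatial_add_smul (x : E4) (s : ℝ) :
    E4.spatial (x + s • E4.basisVector 0) = E4.spatial x := by
  ext i
  simp [E4.spatial_apply, Fin.succ_ne_zero]

/-- The hyperboloidal time of `x + s e₀` is `τ(x) + s`. [folklore] -/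
private theorem htime_add_smul (x : E4) (s : ℝ) :
    (hypBackground ⊤).time (x + s • E4.basisVector 0) = (hypBackground ⊤).time x + s := by
  have hsp : E4.spatialNorm (x + s • E4.basisVector 0) = E4.spatialNorm x := by
    unfold E4.spatialNorm
    rw [spatial_add_smul]
  rw [hypBackground_time, hypBackground_time, time_add_smul, hsp]
  ring

/-- The hyperboloidal time of `x − s e₀` is `τ(x) − s`. [folklore] -/
private theorem htime_sub_smul (x : E4) (s : ℝ) :
    (hypBackground ⊤).time (x - s • E4.basisVector 0) = (hypBackground ⊤).time x - s := by
  rw [sub_eq_add_neg, ← neg_smul, htime_add_smul]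
  ring

/-- **KEY LEMMA** (hyperboloidal time is non-decreasing along the causal relation of Minkowski
space, quantitative form): if `‖q̲ − p̲‖ ≤ q⁰ − p⁰` then `τ(p) ≤ τ(q)`, because
`|q̲| ≤ |p̲| + (q⁰ − p⁰)` and `s ↦ √(1 + s²)` is non-decreasing and `1`-Lipschitz on `[0, ∞)`:
`√(1 + (b + d)²) ≤ √(1 + b²) + d` for `b, d ≥ 0`. Hawking–Ellis 1973, §5.1 (the spacelike
hyperboloids of Minkowski space are acausal). [folklore] -/
private theorem htime_le_of_norm_le {p q : E4} (h : ‖E4.spatial q - E4.spatial p‖ ≤ q 0 - p 0) :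
    (hypBackground ⊤).time p ≤ (hypBackground ⊤).time q := by
  rw [hypBackground_time, hypBackground_time]
  have ha : 0 ≤ E4.spatialNorm q := E4.spatialNorm_nonneg q
  have hb : 0 ≤ E4.spatialNorm p := E4.spatialNorm_nonneg p
  have hd : 0 ≤ q 0 - p 0 := (norm_nonneg _).trans h
  have hab : E4.spatialNorm q ≤ E4.spatialNorm p + (q 0 - p 0) := by
    have := norm_sub_norm_le (E4.spatial q) (E4.spatial p)
    unfold E4.spatialNorm
    linarith
  have hbs : E4.spatialNorm p ≤ √(1 + E4.spatialNorm p ^ 2) :=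
    Real.le_sqrt_of_sq_le (by linarith)
  have h1 : √(1 + E4.spatialNorm q ^ 2) ≤ √(1 + (E4.spatialNorm p + (q 0 - p 0)) ^ 2) :=
    Real.sqrt_le_sqrt (by linarith [pow_le_pow_left₀ ha hab 2])
  have h2 : √(1 + (E4.spatialNorm p + (q 0 - p 0)) ^ 2) ≤
      √(1 + E4.spatialNorm p ^ 2) + (q 0 - p 0) := by
    rw [Real.sqrt_le_left (add_nonneg (Real.sqrt_nonneg _) hd)]
    nlinarith [Real.sq_sqrt (by positivity : (0 : ℝ) ≤ 1 + E4.spatialNorm p ^ 2),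
      mul_nonneg hd (sub_nonneg.2 hbs)]
  linarith

/-- A compact subset of `ℝ⁴` has time coordinate bounded above by some `T ≥ 0`. [folklore] -/
private theorem exists_forall_time_le {K : Set E4} (hK : IsCompact K) :
    ∃ T : ℝ, 0 ≤ T ∧ ∀ x ∈ K, x 0 ≤ T := by
  have hc : Continuous fun x : E4 => x 0 := by fun_prop
  obtain ⟨T₀, hT₀⟩ := hK.bddAbove_image hc.continuousOn
  exact ⟨max T₀ 0, le_max_right _ _, fun x hx =>
    (hT₀ (mem_image_of_mem (fun x : E4 => x 0) hx)).trans (le_max_left _ _)⟩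

/-- The translated chart `y ↦ y + T e₀` maps the flat slab `{τ = 0}` onto the sheet `{τ = T}`.
[folklore] -/
private theorem image_timeSlab_translate (T : ℝ) :
    (fun y : (hypBackground ⊤).domain => (y.1 + T • E4.basisVector 0 : E4)) ''
        (hypBackground ⊤).timeSlab 0 = {x : E4 | (hypBackground ⊤).time x = T} := by
  refine Set.ext fun (x : E4) => ⟨?_, fun hx => ⟨⟨x - T • E4.basisVector 0, trivial⟩, ?_, ?_⟩⟩
  · rintro ⟨y, hy, rfl⟩
    show (hypBackground ⊤).time (y.1 + T • E4.basisVector 0) = T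
    rw [htime_add_smul, show (hypBackground ⊤).time y.1 = 0 from hy, zero_add]
  · show (hypBackground ⊤).time (x - T • E4.basisVector 0) = 0
    rw [htime_sub_smul, show (hypBackground ⊤).time x = T from hx, sub_self]
  · exact (sub_add_cancel x (T • E4.basisVector 0) :)

/-! ### §2 The translated identity chart of the Minkowski development -/

/-- `{x⁰ ≥ 0} ⊆ J⁺(ι ℝ³)` in the Minkowski development: `x` lies vertically above the slice point
`(0, x̲)` (`Minkowski.causalFuture_singleton`). O'Neill 1983, Ch. 14, p. 402. [folklore] -/
private theorem mem_causalFuture_range_embed {x : E4} (hx : 0 ≤ x 0) :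
    x ∈ Minkowski.vacuumCauchyDevelopment.metric.causalFuture
      Minkowski.vacuumCauchyDevelopment.timeOrientation
      (range Minkowski.vacuumCauchyDevelopment.embed) := by
  have hJ : x ∈ Minkowski.vacuumCauchyDevelopment.metric.causalFuture
      Minkowski.vacuumCauchyDevelopment.timeOrientation
      ({E4.ofTimeSpace 0 (E4.spatial x)} : Set E4) := by
    refine Minkowski.mem_causalFuture_vacuumCauchyDevelopment ?_
    simp only [E4.spatial_ofTimeSpace, sub_self, norm_zero, E4.ofTimeSpace_apply_zero, sub_zero]
    exact hx
  refine LorentzianMetric.causalFuture_mono (M := Minkowski.vacuumCauchyDevelopment.carrier) ?_ hJ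
  exact singleton_subset_iff.mpr ⟨⟨E4.spatial x, trivial⟩, rfl⟩

/-- The differential of the translated identity chart `y ↦ y + c` of the open submanifold
`⊤ ⊆ E4` is the identity (`mfderiv_comp_subtypeVal'`; Lee 2013, Prop. 3.9). [folklore] -/
private theorem mfderiv_translate_apply (c : E4) (y : (hypBackground ⊤).domain) (v : E4) :
    mfderiv 𝓘(ℝ, E4) 𝓘(ℝ, E4) (fun z : (hypBackground ⊤).domain => (z.1 + c : E4)) y v = v := by
  have h1 : mfderiv 𝓘(ℝ, E4) 𝓘(ℝ, E4) (fun z : (hypBackground ⊤).domain => (z.1 + c : E4)) y =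
      mfderiv 𝓘(ℝ, E4) 𝓘(ℝ, E4) (fun x : E4 => x + c) y.1 :=
    mfderiv_comp_subtypeVal' (fun x : E4 => x + c) y
  have h2 : HasFDerivAt (fun x : E4 => x + c) (ContinuousLinearMap.id ℝ E4) y.1 :=
    (hasFDerivAt_id y.1).add_const c
  rw [h1, (hasMFDerivAt_iff_hasFDerivAt.mpr h2).mfderiv]
  rfl

/-- The translated identity chart is an exact isometry of `η`: its deviation from the flat
background vanishes (`η` is constant and the differential is the identity). Hawking–Ellis 1973,
§5.1 (time translations are isometries of Minkowski space). [folklore] -/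
private theorem deviation_translate (c : E4) (y : (hypBackground ⊤).domain) :
    Minkowski.vacuumCauchyDevelopment.toSpacetime.deviation (hypBackground ⊤)
      (fun z : (hypBackground ⊤).domain => (z.1 + c : E4)) y = 0 := by
  ext v w
  change Minkowski.bilin
      (mfderiv 𝓘(ℝ, E4) 𝓘(ℝ, E4) (fun z : (hypBackground ⊤).domain => (z.1 + c : E4)) y v)
      (mfderiv 𝓘(ℝ, E4) 𝓘(ℝ, E4) (fun z : (hypBackground ⊤).domain => (z.1 + c : E4)) y w) -
    Minkowski.bilin v w = 0
  rw [mfderiv_translate_apply, mfderiv_translate_apply, sub_self]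

/-- Hence the deviation of the translated identity chart, extended by zero off `U₀ = ⊤`, is the
ZERO FUNCTION on `E4` (`deviationExtend_coe`). [folklore] -/
private theorem deviationExtend_translate (c : E4) :
    Minkowski.vacuumCauchyDevelopment.toSpacetime.deviationExtend (hypBackground ⊤)
      (fun z : (hypBackground ⊤).domain => (z.1 + c : E4)) = 0 := by
  funext x
  have := Minkowski.vacuumCauchyDevelopment.toSpacetime.deviationExtend_coe (hypBackground ⊤)
    (fun z : (hypBackground ⊤).domain => (z.1 + c : E4)) ⟨x, trivial⟩
  rw [deviation_translate] at this
  exact this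

/-- So every `Cᵏ` sup norm of the extended deviation of the translated identity chart vanishes:
over ANY subset of `E4` — every slab (clause (14), `Spacetime.deviationCk`) and the whole layer `L₀`
(clause (S₃)) (`supCkENorm_zero`). [folklore] -/
private theorem supCkENorm_deviationExtend_translate (A : Set E4) (c : E4) (k : ℕ) :
    supCkENorm A k (Minkowski.vacuumCauchyDevelopment.toSpacetime.deviationExtend (hypBackground ⊤)
      (fun z : (hypBackground ⊤).domain => (z.1 + c : E4))) = 0 := by
  rw [deviationExtend_translate, supCkENorm_zero]

/-! ### §3 The translated unit hyperboloid (the flat sheet) is achronal -/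

/-- Points of the translated unit hyperboloid `{τ = T}` have `x⁰ = T + √(1 + ‖x̲‖²)`. [folklore] -/
private theorem apply_zero_of_mem_hyperboloid {T : ℝ} {x : E4}
    (hx : (hypBackground ⊤).time x = T) : x 0 = T + √(1 + ‖E4.spatial x‖ ^ 2) := by
  linarith [show x 0 - √(1 + ‖E4.spatial x‖ ^ 2) = T from hx]

/-- **The translated unit hyperboloid of Minkowski space is achronal** (clause (H₄)): for `q, q'`
on `{x⁰ = T + √(1+‖x̲‖²)}`, `q' ∈ I⁺(q) ⊆ J⁺(q)` would give `‖q̲' − q̲‖ ≤ q'⁰ − q⁰ =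
√(1+‖q̲'‖²) − √(1+‖q̲‖²) ≤ |‖q̲'‖ − ‖q̲‖| ≤ ‖q̲' − q̲‖` (`Minkowski.abs_sqrt_one_add_sq_sub_le`),
whence (the bound being strict off the diagonal) `q = q'`, contradicting chronology
(`CauchyDevelopment.isChronological`); the argument of `Minkowski.isAchronal_stretchLeaf_one`, the
constant `T` cancelling. O'Neill 1983, Ch. 14, p. 413.
[cite: ONeillSemiRiemannian1983, Ch. 14, p. 413] -/
private theorem isAchronal_hyperboloid (T : ℝ) :
    Minkowski.vacuumCauchyDevelopment.metric.IsAchronal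
      Minkowski.vacuumCauchyDevelopment.timeOrientation
      {x : E4 | (hypBackground ⊤).time x = T} := by
  intro (q : E4) hq (q' : E4) hq' hI
  have hq0 := apply_zero_of_mem_hyperboloid hq
  have hq'0 := apply_zero_of_mem_hyperboloid hq'
  -- chronological ⇒ causal ⇒ inside the closed cone
  have hJ : q' ∈ Minkowski.vacuumCauchyDevelopment.metric.causalFuture
      Minkowski.vacuumCauchyDevelopment.timeOrientation ({q} : Set E4) :=
    LorentzianMetric.chronologicalFuture_subset_causalFuture
      Minkowski.vacuumCauchyDevelopment.metric Minkowski.vacuumCauchyDevelopment.timeOrientation _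
      hI
  have hcone : ‖E4.spatial q' - E4.spatial q‖ ≤ q' 0 - q 0 :=
    (Set.ext_iff.mp (Minkowski.causalFuture_singleton q) q').mp hJ
  set s := ‖E4.spatial q‖ with hs
  set s' := ‖E4.spatial q'‖ with hs'
  -- the constant `T` cancels in the time difference; the hyperboloid is a 1-Lipschitz graph
  have hd0 : q' 0 - q 0 = √(1 + s' ^ 2) - √(1 + s ^ 2) := by
    rw [hq0, hq'0]
    ring
  have hlip : q' 0 - q 0 ≤ |s' - s| := by
    rw [hd0]
    exact (le_abs_self _).trans (Minkowski.abs_sqrt_one_add_sq_sub_le _ _)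
  have hrev : |s' - s| ≤ ‖E4.spatial q' - E4.spatial q‖ := abs_norm_sub_norm_le _ _
  have hd : q' 0 - q 0 = ‖E4.spatial q' - E4.spatial q‖ := le_antisymm (hlip.trans hrev) hcone
  have heq : ‖E4.spatial q' - E4.spatial q‖ = |s' - s| := le_antisymm (hd ▸ hlip) hrev
  have hsq : √(1 + s' ^ 2) - √(1 + s ^ 2) = |s' - s| := by rw [← hd0, hd, heq]
  have hss_eq : s' = s := by
    by_contra hne
    have hpos : 0 < |s' - s| := abs_pos.2 (sub_ne_zero.2 hne)
    have hs0 : 0 ≤ s := norm_nonneg _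
    have hs0' : 0 ≤ s' := norm_nonneg _
    have hstrict : |s' + s| < √(1 + s' ^ 2) + √(1 + s ^ 2) := by
      rw [abs_of_nonneg (by linarith)]
      have : s' < √(1 + s' ^ 2) := (Real.lt_sqrt hs0').2 (by nlinarith)
      have : s ≤ √(1 + s ^ 2) := (Real.le_sqrt hs0 (by positivity)).2 (by nlinarith)
      linarith
    have hss : √(1 + s ^ 2) ^ 2 = 1 + s ^ 2 := Real.sq_sqrt (by positivity)
    have hss' : √(1 + s' ^ 2) ^ 2 = 1 + s' ^ 2 := Real.sq_sqrt (by positivity)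
    have hprod : (√(1 + s' ^ 2) - √(1 + s ^ 2)) * (√(1 + s' ^ 2) + √(1 + s ^ 2)) =
        (s' - s) * (s' + s) := by nlinarith
    rw [hsq] at hprod
    have hlt : |s' - s| * |s' + s| < |s' - s| * (√(1 + s' ^ 2) + √(1 + s ^ 2)) :=
      mul_lt_mul_of_pos_left hstrict hpos
    have h2 : |s' - s| * |s' + s| = |(s' - s) * (s' + s)| := (abs_mul _ _).symm
    rw [h2, hprod] at hlt
    exact lt_irrefl _ (hlt.trans_le (le_abs_self _))
  have hsp : E4.spatial q' = E4.spatial q := by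
    have : ‖E4.spatial q' - E4.spatial q‖ = 0 := by rw [heq, hss_eq, sub_self, abs_zero]
    exact sub_eq_zero.1 (norm_eq_zero.1 this)
  have htime : E4.time q' = E4.time q := show q' 0 = q 0 by rw [hq0, hq'0, hss_eq]
  have hqq : q' = q := by
    rw [← E4.ofTimeSpace_time_spatial q', ← E4.ofTimeSpace_time_spatial q, htime, hsp]
  subst hqq
  exact Minkowski.vacuumCauchyDevelopment.toCauchyDevelopment.isChronological
    |>.not_mem_chronologicalFuture_self q' hI

/-! ### §4 The translated unit hyperboloid is an exact SOUND `0`-hole leaf -/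

/-- **The sound block.** For `T ≥ 0`, the translated unit hyperboloid `S = {τ = T}` of the
Minkowski development is a SOUND `0`-hole `(ε, k)`-near-Kerr leaf for every `k`, `ε`: flat chart
`y ↦ y + T e₀` on `U₀ = ⊤` with identically vanishing deviation (slab clause (14) AND layer clause
(S₃)), causal clauses as in the module docstring, (S₁), (S₂), (S₄) vacuous over `Fin 0`, (S₅) =
achronality of the sheet `Ψ₀ {τ = 0} = S` (§3). Hawking–Ellis 1973, §5.1. [folklore] -/
private theorem isSoundNearKerrLeaf_hyperboloid {T : ℝ} (hT : 0 ≤ T) (k : ℕ) (ε : ℝ≥0∞) :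
    Minkowski.vacuumCauchyDevelopment.toCauchyDevelopment.IsSoundNearKerrLeaf k ε 0 ![] ![]
      {x : E4 | (hypBackground ⊤).time x = T} := by
  -- the layer `L₀ = {-1 < τ < 1}` is open
  have ht₀c : Continuous fun x : E4 => x 0 - √(1 + E4.spatialNorm x ^ 2) := by
    unfold E4.spatialNorm
    fun_prop
  have hL₀o : IsOpen {y : (hypBackground ⊤).domain |
      -1 < (hypBackground ⊤).time y.1 ∧ (hypBackground ⊤).time y.1 < 1} := by
    simp only [hypBackground_time]
    exact (isOpen_lt continuous_const (ht₀c.comp continuous_subtype_val)).and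
      (isOpen_lt (ht₀c.comp continuous_subtype_val) continuous_const)
  have himg := image_timeSlab_translate T
  refine ⟨Fin.elim0, Fin.elim0, Fin.elim0, Fin.elim0, Fin.elim0, ⊤, hypBackground ⊤,
    fun i => i.elim0, fun y => (y.1 + T • E4.basisVector 0 : E4), fun i => i.elim0,
    fun i => i.elim0,
    {y | -1 < (hypBackground ⊤).time y.1 ∧ (hypBackground ⊤).time y.1 < 1},
    {y | 0 < (hypBackground ⊤).time y.1 ∧ (hypBackground ⊤).time y.1 < 1},
    fun i => i.elim0, fun i => i.elim0, rfl, fun i => i.elim0, rfl, rfl, fun i => i.elim0,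
    fun _ _ => trivial, fun i => i.elim0, ?_, ?_, ?_, fun i => i.elim0,
    (supCkENorm_deviationExtend_translate _ (T • E4.basisVector 0) k).trans_le zero_le,
    Subsingleton.pairwise, fun i => i.elim0, fun i => i.elim0, ?_, ?_, ?_,
    -- the sound clauses (S₁)–(S₅)
    fun i => i.elim0, fun i => i.elim0,
    (supCkENorm_deviationExtend_translate _ (T • E4.basisVector 0) k).trans_le zero_le,
    Subsingleton.pairwise, ?_⟩
  · -- (10) the flat chart is smooth on its layer
    exact ((contDiff_id.add contDiff_const).contMDiff.comp contMDiff_subtype_val).contMDiffOn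
  · -- (11) the flat chart is an open embedding of its layer
    exact (Homeomorph.addRight (T • E4.basisVector 0)).isOpenEmbedding.comp
      ((⊤ : Opens E4).isOpen.isOpenEmbedding_subtypeVal.comp hL₀o.isOpenEmbedding_subtypeVal)
  · -- (12) the layer is charted into `J⁺(ι ℝ³) = {x⁰ ≥ 0}`
    rintro _ ⟨y, ⟨hy, -⟩, rfl⟩
    refine mem_causalFuture_range_embed ?_
    have h2 := hypBackground_time_le ⊤ y.1
    rw [time_add_smul]
    linarith
  · -- (18) `S = Ψ₀ {τ = 0}`
    rw [iUnion_of_empty, union_empty]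
    exact himg.symm
  · -- (19) the upper layer `Ψ₀ W₀ = {T < τ < T + 1}` lies in `I⁺(S)` (vertical segments)
    rw [iUnion_of_empty, union_empty]
    rintro _ ⟨y, ⟨hy0, -⟩, rfl⟩
    have key := ReversedModel.mem_chronologicalFuture_add_smul
      (x := y.1 + T • E4.basisVector 0 - (hypBackground ⊤).time y.1 • E4.basisVector 0) hy0
    rw [sub_add_cancel] at key
    refine LorentzianMetric.chronologicalFuture_mono
      (M := Minkowski.vacuumCauchyDevelopment.carrier) (singleton_subset_iff.2 ?_) key
    show (hypBackground ⊤).time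
      (y.1 + T • E4.basisVector 0 - (hypBackground ⊤).time y.1 • E4.basisVector 0) = T
    rw [htime_sub_smul, htime_add_smul]
    ring
  · -- (20) the barrier: `exteriorOf W \ W ⊆ J⁻(S)`
    rw [iUnion_of_empty, union_empty]
    rintro (p : E4) ⟨⟨-, hpI⟩, hpW⟩
    obtain ⟨w, hw, hpw⟩ :=
      ReversedModel.exists_mem_causalPast_singleton_of_mem_chronologicalPast hpI
    obtain ⟨y, ⟨-, hy1⟩, rfl⟩ := hw
    -- `τ p ≤ τ w < T + 1` (`J⁻(w)` is the solid past cone, `Minkowski.causalPast_singleton`)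
    have h1 : (hypBackground ⊤).time p ≤ (hypBackground ⊤).time y.1 + T := by
      rw [← htime_add_smul]
      exact htime_le_of_norm_le ((Set.ext_iff.mp (Minkowski.causalPast_singleton _) p).mp hpw)
    -- `p ∉ W = {T < τ < T + 1}` forces `τ p ≤ T`
    have h2 : (hypBackground ⊤).time p ≤ T := by
      refine not_lt.1 fun hlt => hpW ⟨⟨p - T • E4.basisVector 0, trivial⟩, ?_, ?_⟩
      · show 0 < (hypBackground ⊤).time (p - T • E4.basisVector 0) ∧
          (hypBackground ⊤).time (p - T • E4.basisVector 0) < 1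
        rw [htime_sub_smul]
        constructor <;> linarith
      · exact (sub_add_cancel p (T • E4.basisVector 0) :)
    -- `p` lies vertically below the point `p + (T - τ p) e₀ ∈ S`
    have h3 : p ∈ Minkowski.vacuumCauchyDevelopment.metric.causalPast
        Minkowski.vacuumCauchyDevelopment.timeOrientation
        ({p + (T - (hypBackground ⊤).time p) • E4.basisVector 0} : Set E4) :=
      Minkowski.mem_causalPast_vacuumCauchyDevelopment (by
        rw [spatial_add_smul, sub_self, norm_zero, time_add_smul]
        linarith)
    refine LorentzianMetric.causalFuture_mono (M := Minkowski.vacuumCauchyDevelopment.carrier)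
      (singleton_subset_iff.2 ?_) h3
    show (hypBackground ⊤).time (p + (T - (hypBackground ⊤).time p) • E4.basisVector 0) = T
    rw [htime_add_smul]
    ring
  · -- (S₅) the flat sheet `Ψ₀ {τ = 0} = {τ = T}` is achronal (§3)
    exact fun q hq q' hq' => isAchronal_hyperboloid T q (himg.subset hq) q' (himg.subset hq')

/-! ### §5 Disjointness from `J⁻(K)` and the stub -/

/-- **Disjointness from `J⁻(K)`**: if the time coordinate is `≤ T` on `K`, it is `≤ T` on `J⁻(K)`
(`Minkowski.causalPast_singleton`), while on the leaf `{τ = T}` it is `≥ T + 1`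
(`hypBackground_time_le`). O'Neill 1983, Ch. 14, p. 402. [folklore] -/
private theorem disjoint_hyperboloid_causalPast {T : ℝ} {K : Set E4} (hTK : ∀ x ∈ K, x 0 ≤ T) :
    Disjoint {x : E4 | (hypBackground ⊤).time x = T}
      (Minkowski.vacuumCauchyDevelopment.metric.causalPast
        Minkowski.vacuumCauchyDevelopment.timeOrientation K) := by
  refine Set.disjoint_left.2 fun x hxS hxK => ?_
  obtain ⟨q, hqK, hxq⟩ := ReversedModel.exists_mem_causalPast_singleton_of_mem_causalPast hxK
  have h1 := ReversedModel.time_le_of_mem_causalPast_singleton hxq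
  have h2 := hTK q hqK
  have h3 := hypBackground_time_le ⊤ x
  rw [show (hypBackground ⊤).time x = T from hxS] at h3
  linarith

/-- **Sound anti-vacuity at `N = 0`** (stub `stub_minkowskiSoundLeaf` of crux `Capture`,
stmt-FinalStateConjecture-10115): Minkowski spacetime — the vacuum Cauchy development
`Minkowski.vacuumCauchyDevelopment` of the trivial datum `(ℝ³, δ, 0)` — has, for every `k`, every
`ε : ℝ≥0∞` (even `ε = 0`) and every compact `K`, a SOUND `0`-hole `(ε, k)`-near-Kerr leaf
(`CauchyDevelopment.IsSoundNearKerrLeaf`) disjoint from `J⁻(K)`: the unit hyperboloid `{τ = T}`,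
`T ≥ max (sup_K x⁰, 0)`, with the translated identity chart as flat chart (deviation identically
zero: slab AND layer certified at `ε = 0`); (S₁), (S₂), (S₄) quantify over `Fin 0`, and (S₅) is the
achronality of the sheet = the whole leaf (`isAchronal_hyperboloid`). O'Neill 1983, Ch. 14, p. 413;
Hawking–Ellis 1973, §5.1. [cite: ONeillSemiRiemannian1983, Ch. 14, p. 413] -/
theorem stub_minkowskiSoundLeaf :
    ∀ (k : ℕ) (ε : ℝ≥0∞) (K : Set Minkowski.vacuumCauchyDevelopment.carrier), IsCompact K →
      ∃ S : Set Minkowski.vacuumCauchyDevelopment.carrier,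
        Disjoint S (Minkowski.vacuumCauchyDevelopment.metric.causalPast
            Minkowski.vacuumCauchyDevelopment.timeOrientation K) ∧
          Minkowski.vacuumCauchyDevelopment.toCauchyDevelopment.IsSoundNearKerrLeaf k ε 0 ![] ![]
            S := by
  intro k ε K hK
  obtain ⟨T, hT0, hTK⟩ := exists_forall_time_le hK
  exact ⟨{x : E4 | (hypBackground ⊤).time x = T}, disjoint_hyperboloid_causalPast hTK,
    isSoundNearKerrLeaf_hyperboloid hT0 k ε⟩

end Summit.FinalStateConjecture.FinalStateConjecture.Theorems.BartnikGapSettling.Capture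

end
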